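import Literature.Barriers.RiemannHypothesis.TuranPartialSumsSmoothedModel
import HarnessLib

/-!
# Montgomery 1983 for smoothed sections: the closing argument, uniformly in the kernel

Proofs-only companion of `Literature/Barriers/RiemannHypothesis/TuranPartialSums.lean` (named fact
`Literature.Barriers.RiemannHypothesis.montgomery1983_smoothedRemark`, Montgomery 1983, §1 p. 498: "our proof
of the Theorem, mutatis mutandis, applies to these functions [`C_N`, `V_N`, `A_N`] as well"). No definitions,
no named facts.

The end of §4 of the source, written once for all three smoothings. An entire `F` (the smoothed twisted
section) is compared on the box `U = modelBox Λ σ₁ σ₂` (`σ_j = 1 + c_j log Λ/Λ`, `c₁ = c*/2`, `c₂ = c* + 1`,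
`c* = b̂(1) − b̂(0) − 1 > 0`) with the two-term model `ρ(s) f(s) + a₀ q(s) e^{−Λ(s−1)}` ((24); `ρ ≡ 1` for
`C_N`, `A_N` and `ρ = 2a(2)2^{−s} − 1` for `V_N`; `q` the frozen kernel factor):

* `exists_zero_of_good` — if `Λ` satisfies an explicit finite list of inequalities (the box fits, the line
  error is `≤ ε₁ H Λ^{β−1}`, the first term dominates at `σ₁` and the second at `σ₂` ((25)), the Rouché margin
  is positive), then `F` has a zero with `Re s > σ₁ − 1/(2Λ)` (`exists_zero_of_twoTermModel` fed with
  `norm_montgomeryF_modelBox`, `norm_deriv_montgomeryF_modelBox`, `norm_aZero_bounds`);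
* `eventually_good` — for a suitable fixed `ε₁ > 0` all these inequalities hold for large `Λ`
  (`eventually_lineErr_le` and `(log Λ)^{b̂(0)} = o(Λ^{c*/2})`).

## References

* [Montgomery1983] H. L. Montgomery, *Zeros of approximations to the zeta function*, Studies in Pure
  Mathematics (Turán memorial), Birkhäuser 1983, 497–506: §1 p. 498, §4 (24)–(25) and p. 506.
-/

noncomputable section

open Complex Set Filter Topology Asymptotics

namespace Literature.Barriers.RiemannHypothesis

section Generic

variable (m : ℕ)

variable {A₁ A₂ A₃ A₄ : ℝ}
  (h18 : ∀ (k : ℤ) (z : ℂ), 1 < z.re → z.re ≤ 2 → |z.im - k| ≤ 1 / 2 →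
    ‖montgomeryPhi m z + (montgomeryCoeff m k : ℂ) * log (z - 1 - k * I)‖ ≤
      A₁ + A₂ * Real.log (Real.log (|(k : ℝ)| + 5)))
  (h19 : ∀ (k : ℤ) (z : ℂ), 1 < z.re → z.re ≤ 2 → |z.im - k| ≤ 1 / 2 →
    ‖montgomeryPhiDeriv m z + (montgomeryCoeff m k : ℂ) / (z - 1 - k * I)‖ ≤ A₃ + A₄ * Real.log (|(k : ℝ)| + 5))
include h18 h19

/-- **A zero beyond `σ₁ − 1/(2Λ)`, for every good `Λ`.** With `c* = b̂(1) − b̂(0) − 1 > 0`, `c₁ = c*/2`,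
`c₂ = c* + 1`, `σ_j = 1 + c_j log Λ/Λ`, `K₀ = ⌈Λ³⌉`, `G₀ = A₁ + A₂ log log 5`, `G₁ = A₁ + A₂ log log 6`,
`L₀ = A₃ + A₄ log 5`: let `F` be holomorphic on the box with
`‖F(s) − ρ(s)f(s) − a₀ q(s) e^{−Λ(s−1)}‖ ≤ (e/2π)(lineErr(H, Λ, |α|/2, Λ^{-1/2}, K₀) + 44Λ^{−2}) e^{−Λ(σ−1)}` on the
box, where `ρ` is holomorphic with `ρ₁ ≤ |ρ| ≤ ρ₂`, `|ρ'| ≤ ρ₃` and `q₀ ≤ |q| ≤ q₁`, `q` `L_q`-Lipschitz there.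
If `Λ` satisfies the (finitely many, eventually true) inequalities listed as hypotheses, then `F` has a zero
with `Re s > σ₁ − 1/(2Λ)`. [cite: Montgomery1983, §4 (24)–(25) and p. 506] -/
theorem exists_zero_of_good (hcs : 0 < montgomeryCoeff m 1 - montgomeryCoeff m 0 - 1)
    {Λ ε₁ H q₀ q₁ Lq ρ₁ ρ₂ ρ₃ : ℝ} (hε₁ : 0 ≤ ε₁) (hH : 0 ≤ H) (hq₀ : 0 < q₀) (hLq : 0 ≤ Lq) (hρ₁ : 0 < ρ₁)
    (hρ₃ : 0 ≤ ρ₃) {F ρ q : ℂ → ℂ} (hF : DifferentiableOn ℂ F (modelBox Λ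
      (1 + (montgomeryCoeff m 1 - montgomeryCoeff m 0 - 1) / 2 * Real.log Λ / Λ)
      (1 + (montgomeryCoeff m 1 - montgomeryCoeff m 0 - 1 + 1) * Real.log Λ / Λ)))
    (hρd : DifferentiableOn ℂ ρ (modelBox Λ
      (1 + (montgomeryCoeff m 1 - montgomeryCoeff m 0 - 1) / 2 * Real.log Λ / Λ)
      (1 + (montgomeryCoeff m 1 - montgomeryCoeff m 0 - 1 + 1) * Real.log Λ / Λ)))
    (hρb : ∀ s ∈ modelBox Λ
      (1 + (montgomeryCoeff m 1 - montgomeryCoeff m 0 - 1) / 2 * Real.log Λ / Λ)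
      (1 + (montgomeryCoeff m 1 - montgomeryCoeff m 0 - 1 + 1) * Real.log Λ / Λ),
      ρ₁ ≤ ‖ρ s‖ ∧ ‖ρ s‖ ≤ ρ₂ ∧ ‖deriv ρ s‖ ≤ ρ₃)
    (hqb : ∀ s ∈ modelBox Λ
      (1 + (montgomeryCoeff m 1 - montgomeryCoeff m 0 - 1) / 2 * Real.log Λ / Λ)
      (1 + (montgomeryCoeff m 1 - montgomeryCoeff m 0 - 1 + 1) * Real.log Λ / Λ),
      q₀ ≤ ‖q s‖ ∧ ‖q s‖ ≤ q₁)
    (hqL : ∀ s ∈ modelBox Λ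
      (1 + (montgomeryCoeff m 1 - montgomeryCoeff m 0 - 1) / 2 * Real.log Λ / Λ)
      (1 + (montgomeryCoeff m 1 - montgomeryCoeff m 0 - 1 + 1) * Real.log Λ / Λ), ∀ s' ∈ modelBox Λ
      (1 + (montgomeryCoeff m 1 - montgomeryCoeff m 0 - 1) / 2 * Real.log Λ / Λ)
      (1 + (montgomeryCoeff m 1 - montgomeryCoeff m 0 - 1 + 1) * Real.log Λ / Λ),
      ‖q s - q s'‖ ≤ Lq * ‖s - s'‖)
    (hmodel : ∀ s ∈ modelBox Λ
      (1 + (montgomeryCoeff m 1 - montgomeryCoeff m 0 - 1) / 2 * Real.log Λ / Λ)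
      (1 + (montgomeryCoeff m 1 - montgomeryCoeff m 0 - 1 + 1) * Real.log Λ / Λ),
      ‖F s - ρ s * montgomeryF m s -
        (exp ((Λ : ℂ) * I) * ((Λ ^ (montgomeryCoeff m 1 - 1) / Real.Gamma (montgomeryCoeff m 1) : ℝ) : ℂ) *
          gOne m Λ 0) * q s * exp (-(Λ : ℂ) * (s - 1))‖ ≤
      Real.exp 1 / (2 * Real.pi) *
        (lineErr m A₁ A₂ A₃ A₄ H Λ (|1 + 1 / Λ - s.re| / 2) (Λ ^ (-(1 / 2 : ℝ))) ⌈Λ ^ 3⌉₊ + 44 * Λ ^ (-2 : ℝ)) *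
        Real.exp (-Λ * (s.re - 1)))
    (g1 : 20 ≤ Λ) (g3 : 12 ≤ (montgomeryCoeff m 1 - montgomeryCoeff m 0 - 1) / 2 * Real.log Λ)
    (g4 : (montgomeryCoeff m 1 - montgomeryCoeff m 0 - 1 + 1) * Real.log Λ + 6 ≤ Λ / 64)
    (g5 : ∀ (a : ℝ) (K : ℕ), 1 / Λ ≤ a → 1 ≤ K → (K : ℝ) ≤ Λ ^ 4 →
      lineErr m A₁ A₂ A₃ A₄ H Λ a (Λ ^ (-(1 / 2 : ℝ))) K ≤ ε₁ * H * Λ ^ (montgomeryCoeff m 1 - 1))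
    (g6 : ρ₂ * (((montgomeryCoeff m 1 - montgomeryCoeff m 0 - 1) / 2 * Real.log Λ / Λ) ^
          (-montgomeryCoeff m 0) * Real.exp (A₁ + A₂ * Real.log (Real.log 5))) <
        Λ ^ (montgomeryCoeff m 1 - 1) / Real.Gamma (montgomeryCoeff m 1) *
          Real.exp (-(A₁ + A₂ * Real.log (Real.log 6))) * q₀ *
          Real.exp (-((montgomeryCoeff m 1 - montgomeryCoeff m 0 - 1) / 2 * Real.log Λ)))
    (g7 : Λ ^ (montgomeryCoeff m 1 - 1) / Real.Gamma (montgomeryCoeff m 1) *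
          Real.exp (A₁ + A₂ * Real.log (Real.log 6)) * q₁ *
          Real.exp (-((montgomeryCoeff m 1 - montgomeryCoeff m 0 - 1 + 1) * Real.log Λ)) <
        ρ₁ * (((montgomeryCoeff m 1 - montgomeryCoeff m 0 - 1 + 1) * Real.log Λ / Λ) ^
          (-montgomeryCoeff m 0) * Real.exp (-(A₁ + A₂ * Real.log (Real.log 5)))))
    (g8 : Real.exp (1 / 2) *
          (Real.exp 1 / (2 * Real.pi) * (ε₁ * H + 44 * Λ ^ (-1 - montgomeryCoeff m 1)) *
              Real.Gamma (montgomeryCoeff m 1) * Real.exp (A₁ + A₂ * Real.log (Real.log 6)) +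
            5 * Lq / Λ) / q₀ +
        5 * (ρ₂ * ((((montgomeryCoeff m 1 - montgomeryCoeff m 0 - 1 + 1) * Real.log Λ + 6) / Λ) ^
              (-montgomeryCoeff m 0) * Real.exp (A₁ + A₂ * Real.log (Real.log 5)) *
            ((-montgomeryCoeff m 0) * (Λ / ((montgomeryCoeff m 1 - montgomeryCoeff m 0 - 1) / 2 *
              Real.log Λ - 1)) + (A₃ + A₄ * Real.log 5))) +
            ρ₃ * ((((montgomeryCoeff m 1 - montgomeryCoeff m 0 - 1 + 1) * Real.log Λ + 6) / Λ) ^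
              (-montgomeryCoeff m 0) * Real.exp (A₁ + A₂ * Real.log (Real.log 5)))) /
          (Λ * (ρ₁ * ((((montgomeryCoeff m 1 - montgomeryCoeff m 0 - 1) / 2 * Real.log Λ - 1) / Λ) ^
            (-montgomeryCoeff m 0) * Real.exp (-(A₁ + A₂ * Real.log (Real.log 5)))))) < 1 / 8) :
    ∃ s : ℂ, F s = 0 ∧
      1 + (montgomeryCoeff m 1 - montgomeryCoeff m 0 - 1) / 2 * Real.log Λ / Λ - 1 / (2 * Λ) < s.re := by
  -- notation
  set LL := Real.log Λ with hLL
  set b₁ := montgomeryCoeff m 1 with hb₁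
  set b₀ := montgomeryCoeff m 0 with hb₀
  set cs := b₁ - b₀ - 1 with hcsdef
  set c₁ := cs / 2 with hc₁def
  set c₂ := cs + 1 with hc₂def
  set ℓ₀ := A₁ + A₂ * Real.log (Real.log 5) with hℓ₀
  set ℓ₁ := A₁ + A₂ * Real.log (Real.log 6) with hℓ₁
  set L₀ := A₃ + A₄ * Real.log 5 with hL₀
  have hΛ0 : 0 < Λ := by linarith only [g1]
  have hLL0 : 0 < LL := Real.log_pos (by linarith only [g1])
  have hγ0 : 0 < -b₀ := by have := (montgomeryCoeff_zero_bounds m).2; rw [hb₀]; linarith only [this]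
  have hβ0 : 0 < b₁ := by have := (montgomeryCoeff_one_bounds m).1; rw [hb₁]; linarith only [this]
  have hc₁pos : 0 < c₁ := by rw [hc₁def]; linarith only [hcs]
  have hc₁₂ : c₁ ≤ c₂ := by rw [hc₁def, hc₂def]; linarith only [hcs]
  have hc₁' : 12 ≤ c₁ * LL := g3
  have hc₂' : c₂ * LL + 6 ≤ Λ / 2 := by have : c₂ * LL + 6 ≤ Λ / 64 := g4; linarith only [this, hΛ0]
  set σ₁ := 1 + c₁ * LL / Λ with hσ₁
  set σ₂ := 1 + c₂ * LL / Λ with hσ₂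
  set U := modelBox Λ σ₁ σ₂ with hU
  -- the real endpoints lie in the box
  have hσ₁₂ : σ₁ ≤ σ₂ := by
    have e1 := mul_le_mul_of_nonneg_right hc₁₂ hLL0.le
    have e2 := div_le_div_of_nonneg_right e1 hΛ0.le
    rw [hσ₁, hσ₂]; linarith only [e2]
  have hmem : ∀ {σ : ℝ}, σ₁ ≤ σ → σ ≤ σ₂ → (σ : ℂ) ∈ U := fun h1 h2 ↦ ofReal_mem_modelBox hΛ0 h1 h2
  -- the ingredients on the box
  have hbasic : ∀ s ∈ U, 1 + 11 / Λ ≤ s.re ∧ s.re ≤ 3 / 2 ∧ |s.im| ≤ 5 / Λ ∧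
      (c₁ * LL - 1) / Λ ≤ ‖s - 1‖ ∧ ‖s - 1‖ ≤ (c₂ * LL + 6) / Λ ∧ (c₁ * LL - 1) / Λ ≤ s.re - 1 :=
    fun s hs ↦ modelBox_basic g1 hc₁' hc₂' hs
  set r₁ := ((c₁ * LL - 1) / Λ) ^ (-b₀) * Real.exp (-ℓ₀) with hr₁
  set r₂ := ((c₂ * LL + 6) / Λ) ^ (-b₀) * Real.exp ℓ₀ with hr₂
  set D' := r₂ * ((-b₀) * (Λ / (c₁ * LL - 1)) + L₀) with hD'
  have hr₁pos : 0 < r₁ := mul_pos (Real.rpow_pos_of_pos (div_pos (by linarith only [hc₁']) hΛ0) _) (Real.exp_pos _)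
  have hr₂nn : 0 ≤ r₂ := by positivity
  have hRbounds : ∀ s ∈ U, r₁ ≤ ‖montgomeryF m s‖ ∧ ‖montgomeryF m s‖ ≤ r₂ :=
    fun s hs ↦ norm_montgomeryF_modelBox m h18 g1 hc₁' hc₂' hs
  have hR' : ∀ s ∈ U, ‖deriv (montgomeryF m) s‖ ≤ D' :=
    fun s hs ↦ norm_deriv_montgomeryF_modelBox m h18 h19 g1 hc₁' hc₁₂ hc₂' hs
  have hD'nn : 0 ≤ D' := (norm_nonneg _).trans (hR' _ (hmem le_rfl hσ₁₂))
  have h11pos : 0 < 11 / Λ := div_pos (by norm_num) hΛ0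
  have hfd : ∀ s ∈ U, DifferentiableAt ℂ (montgomeryF m) s := by
    intro s hs
    obtain ⟨h1, h2, -⟩ := hbasic s hs
    exact differentiableAt_montgomeryF m (by linarith only [h1, h11pos]) (by linarith only [h2])
  -- `R = ρ f`
  have hUo : IsOpen U := isOpen_modelBox _ _ _
  have hRd : DifferentiableOn ℂ (fun s ↦ ρ s * montgomeryF m s) U :=
    fun s hs ↦ ((hρd s hs).differentiableAt (hUo.mem_nhds hs)).differentiableWithinAt.mul
      (hfd s hs).differentiableWithinAt
  have hR₁ : ∀ s ∈ U, ρ₁ * r₁ ≤ ‖ρ s * montgomeryF m s‖ := by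
    intro s hs
    rw [norm_mul]
    exact mul_le_mul (hρb s hs).1 (hRbounds s hs).1 hr₁pos.le (norm_nonneg _)
  have hRderiv : ∀ s ∈ U, ‖deriv (fun s ↦ ρ s * montgomeryF m s) s‖ ≤ ρ₂ * D' + ρ₃ * r₂ := by
    intro s hs
    have hρs := (hρd s hs).differentiableAt (hUo.mem_nhds hs)
    rw [deriv_fun_mul hρs (hfd s hs)]
    obtain ⟨-, h2, h3⟩ := hρb s hs
    calc ‖deriv ρ s * montgomeryF m s + ρ s * deriv (montgomeryF m) s‖
        ≤ ‖deriv ρ s‖ * ‖montgomeryF m s‖ + ‖ρ s‖ * ‖deriv (montgomeryF m) s‖ := by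
          refine (norm_add_le _ _).trans ?_; rw [norm_mul, norm_mul]
      _ ≤ ρ₃ * r₂ + ρ₂ * D' := add_le_add (mul_le_mul h3 (hRbounds s hs).2 (norm_nonneg _) hρ₃)
          (mul_le_mul h2 (hR' s hs) (norm_nonneg _) ((norm_nonneg _).trans h2))
      _ = ρ₂ * D' + ρ₃ * r₂ := by ring
  -- the coefficient `a₀`
  set a₀ : ℂ := exp ((Λ : ℂ) * I) * ((Λ ^ (b₁ - 1) / Real.Gamma b₁ : ℝ) : ℂ) * gOne m Λ 0 with ha₀
  obtain ⟨ha₀ne, hamin, hamax⟩ := norm_aZero_bounds m h18 (Λ := Λ) (by linarith only [g1])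
  rw [← hb₁, ← ha₀, ← hℓ₁] at hamin hamax
  rw [← hb₁, ← ha₀] at ha₀ne
  -- `K₀ = ⌈Λ³⌉`
  set K₀ : ℕ := ⌈Λ ^ 3⌉₊ with hK₀
  have hK₀ge : Λ ^ 3 ≤ (K₀ : ℝ) := Nat.le_ceil _
  have hΛ1 : 1 ≤ Λ := by linarith only [g1]
  have hK₀1 : 1 ≤ K₀ := by
    have : (1 : ℝ) ≤ K₀ := le_trans (one_le_pow₀ hΛ1) hK₀ge
    exact_mod_cast this
  have hK₀le : (K₀ : ℝ) ≤ Λ ^ 4 := by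
    have h1 : (K₀ : ℝ) < Λ ^ 3 + 1 := Nat.ceil_lt_add_one (by positivity)
    have hΛ3 : 1 ≤ Λ ^ 3 := one_le_pow₀ hΛ1
    have h2 : Λ ^ 3 + 1 ≤ Λ ^ 4 :=
      calc Λ ^ 3 + 1 ≤ Λ ^ 3 + Λ ^ 3 := by linarith only [hΛ3]
        _ = 2 * Λ ^ 3 := by ring
        _ ≤ Λ * Λ ^ 3 := mul_le_mul_of_nonneg_right (by linarith only [g1]) (by positivity)
        _ = Λ ^ 4 := by ring
    linarith only [h1, h2]
  -- `ε`
  set ε : ℝ := Real.exp 1 / (2 * Real.pi) * (ε₁ * H + 44 * Λ ^ (-1 - b₁)) * Real.Gamma b₁ * Real.exp ℓ₁ with hεdef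
  have hΓpos : 0 < Real.Gamma b₁ := Real.Gamma_pos_of_pos hβ0
  have hεpos : 0 ≤ ε := by rw [hεdef]; positivity
  have htail : 44 * Λ ^ (-2 : ℝ) = 44 * Λ ^ (-1 - b₁) * Λ ^ (b₁ - 1) := by
    rw [mul_assoc, ← Real.rpow_add hΛ0]; norm_num
  -- the model on the box
  have hFmodel : ∀ s ∈ U, ‖F s - ρ s * montgomeryF m s - a₀ * q s * exp (-(Λ : ℂ) * (s - 1))‖ ≤
      ε * ‖a₀‖ * Real.exp (-Λ * (s.re - 1)) := by
    intro s hs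
    obtain ⟨h1, h2, h3, -, -, h6⟩ := hbasic s hs
    have hM := hmodel s hs
    refine hM.trans ?_
    have e3 : 3 / Λ ≤ 11 / Λ := div_le_div_of_nonneg_right (by norm_num) hΛ0.le
    have e4 : 1 / Λ ≤ 11 / Λ := div_le_div_of_nonneg_right (by norm_num) hΛ0.le
    have ha : 1 / Λ ≤ |1 + 1 / Λ - s.re| / 2 := by
      rw [abs_of_nonpos (by linarith only [h1, e4]), le_div_iff₀ two_pos]
      have : 1 / Λ * 2 + 1 / Λ = 3 / Λ := by ring
      linarith only [this, e3, h1]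
    have hline := g5 _ K₀ ha hK₀1 hK₀le
    have hexp : 0 < Real.exp (-Λ * (s.re - 1)) := Real.exp_pos _
    calc Real.exp 1 / (2 * Real.pi) * (lineErr m A₁ A₂ A₃ A₄ H Λ (|1 + 1 / Λ - s.re| / 2) (Λ ^ (-(1 / 2 : ℝ))) K₀ +
          44 * Λ ^ (-2 : ℝ)) * Real.exp (-Λ * (s.re - 1))
        ≤ Real.exp 1 / (2 * Real.pi) * (ε₁ * H * Λ ^ (b₁ - 1) + 44 * Λ ^ (-1 - b₁) * Λ ^ (b₁ - 1)) *
            Real.exp (-Λ * (s.re - 1)) := by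
          rw [htail]
          refine mul_le_mul_of_nonneg_right (mul_le_mul_of_nonneg_left (add_le_add hline le_rfl) (by positivity))
            hexp.le
      _ = ε * (Λ ^ (b₁ - 1) / Real.Gamma b₁ * Real.exp (-ℓ₁)) * Real.exp (-Λ * (s.re - 1)) := by
          rw [hεdef, Real.exp_neg]; field_simp
      _ ≤ ε * ‖a₀‖ * Real.exp (-Λ * (s.re - 1)) :=
          mul_le_mul_of_nonneg_right (mul_le_mul_of_nonneg_left hamin hεpos) hexp.le
  -- the endpoints
  have hσ₁U : (σ₁ : ℂ) ∈ U := hmem le_rfl hσ₁₂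
  have hσ₂U : (σ₂ : ℂ) ∈ U := hmem hσ₁₂ le_rfl
  have hσ₁re : (σ₁ : ℂ).re = σ₁ := ofReal_re _
  have hσ₂re : (σ₂ : ℂ).re = σ₂ := ofReal_re _
  have hc₁nn : 0 ≤ c₁ * LL / Λ := by positivity
  have hnorm₁ : ‖(σ₁ : ℂ) - 1‖ = c₁ * LL / Λ := by
    rw [show (σ₁ : ℂ) - 1 = ((σ₁ - 1 : ℝ) : ℂ) by push_cast; ring, norm_real, Real.norm_eq_abs, hσ₁,
      abs_of_nonneg (by linarith only [hc₁nn])]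
    ring
  have hc₂nn : 0 ≤ c₂ * LL / Λ := by
    have : 0 ≤ c₂ := by linarith only [hc₁pos, hc₁₂]
    positivity
  have hnorm₂ : ‖(σ₂ : ℂ) - 1‖ = c₂ * LL / Λ := by
    rw [show (σ₂ : ℂ) - 1 = ((σ₂ - 1 : ℝ) : ℂ) by push_cast; ring, norm_real, Real.norm_eq_abs, hσ₂,
      abs_of_nonneg (by linarith only [hc₂nn])]
    ring
  have hσ₁gt : 1 < σ₁ := by
    have : 0 < c₁ * LL / Λ := by positivity
    rw [hσ₁]; linarith only [this]
  have hσ₂gt : 1 < σ₂ := by linarith only [hσ₁gt, hσ₁₂]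
  have hρ₂nn : 0 ≤ ρ₂ := hρ₁.le.trans ((hρb _ hσ₁U).1.trans (hρb _ hσ₁U).2.1)
  have hend₁ : ‖ρ σ₁ * montgomeryF m σ₁‖ < ‖a₀ * q σ₁‖ * Real.exp (-Λ * (σ₁ - 1)) := by
    obtain ⟨h1, h2, h3, -⟩ := hbasic _ hσ₁U
    rw [hσ₁re] at h2
    have hup := (norm_montgomeryF_near_one m h18 (z := (σ₁ : ℂ)) (by rw [hσ₁re]; exact hσ₁gt)
      (by rw [hσ₁re]; exact h2) (by simp)).1
    rw [hnorm₁, ← hb₀, ← hℓ₀] at hup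
    have hexp : Real.exp (-Λ * (σ₁ - 1)) = Real.exp (-(c₁ * LL)) := by
      congr 1; rw [hσ₁]; field_simp; ring
    rw [hexp, norm_mul (ρ _), norm_mul a₀]
    calc ‖ρ σ₁‖ * ‖montgomeryF m σ₁‖ ≤ ρ₂ * ((c₁ * LL / Λ) ^ (-b₀) * Real.exp ℓ₀) :=
          mul_le_mul (hρb _ hσ₁U).2.1 hup (norm_nonneg _) hρ₂nn
      _ < Λ ^ (b₁ - 1) / Real.Gamma b₁ * Real.exp (-ℓ₁) * q₀ * Real.exp (-(c₁ * LL)) := g6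
      _ ≤ ‖a₀‖ * ‖q σ₁‖ * Real.exp (-(c₁ * LL)) := by
          refine mul_le_mul_of_nonneg_right (mul_le_mul hamin (hqb _ hσ₁U).1 hq₀.le (norm_nonneg _))
            (Real.exp_pos _).le
  have hend₂ : ‖a₀ * q σ₂‖ * Real.exp (-Λ * (σ₂ - 1)) < ‖ρ σ₂ * montgomeryF m σ₂‖ := by
    obtain ⟨h1, h2, h3, -⟩ := hbasic _ hσ₂U
    rw [hσ₂re] at h2
    have hlow := (norm_montgomeryF_near_one m h18 (z := (σ₂ : ℂ)) (by rw [hσ₂re]; exact hσ₂gt)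
      (by rw [hσ₂re]; exact h2) (by simp)).2
    rw [hnorm₂, ← hb₀, ← hℓ₀] at hlow
    have hexp : Real.exp (-Λ * (σ₂ - 1)) = Real.exp (-(c₂ * LL)) := by
      congr 1; rw [hσ₂]; field_simp; ring
    have hq₁nn : 0 ≤ q₁ := hq₀.le.trans ((hqb _ hσ₂U).1.trans (hqb _ hσ₂U).2)
    rw [hexp, norm_mul (ρ _), norm_mul a₀]
    calc ‖a₀‖ * ‖q σ₂‖ * Real.exp (-(c₂ * LL))
        ≤ Λ ^ (b₁ - 1) / Real.Gamma b₁ * Real.exp ℓ₁ * q₁ * Real.exp (-(c₂ * LL)) := by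
          refine mul_le_mul_of_nonneg_right (mul_le_mul hamax (hqb _ hσ₂U).2 (norm_nonneg _) (by positivity))
            (Real.exp_pos _).le
      _ < ρ₁ * ((c₂ * LL / Λ) ^ (-b₀) * Real.exp (-ℓ₀)) := g7
      _ ≤ ‖ρ σ₂‖ * ‖montgomeryF m σ₂‖ := mul_le_mul (hρb _ hσ₂U).1 hlow (by positivity) (norm_nonneg _)
  -- the Rouché margin
  have hsmall : Real.exp (1 / 2) * (ε + 5 * Lq / Λ) / q₀ + 5 * (ρ₂ * D' + ρ₃ * r₂) / (Λ * (ρ₁ * r₁)) < 1 / 8 := by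
    have e : 5 * (ρ₂ * D' + ρ₃ * r₂) / (Λ * (ρ₁ * r₁)) =
        5 * (ρ₂ * (((c₂ * LL + 6) / Λ) ^ (-b₀) * Real.exp ℓ₀ * (-b₀ * (Λ / (c₁ * LL - 1)) + L₀)) +
          ρ₃ * (((c₂ * LL + 6) / Λ) ^ (-b₀) * Real.exp ℓ₀)) / (Λ * (ρ₁ * r₁)) := by
      rw [hD', hr₂]
    rw [e]; exact g8
  -- conclude
  obtain ⟨s, hs0, hs1, -⟩ := exists_zero_of_twoTermModel (F := F) (R := fun s ↦ ρ s * montgomeryF m s)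
    (q := q) (a₀ := a₀) hΛ0 hσ₁₂ hRd hR₁ (mul_pos hρ₁ hr₁pos) hRderiv hqL hLq (fun s hs ↦ (hqb s hs).1)
    hq₀ ha₀ne hF hFmodel hεpos hend₁ hend₂ hsmall
  exact ⟨s, hs0, by rw [hσ₁] at hs1; exact hs1⟩

omit h18 h19 in
/-- **All the conditions hold for large `Λ`** (for a suitable fixed `ε₁ > 0`, given the kernel constants
`H, q₀, q₁, L_q, ρ₁, ρ₂, ρ₃`): the box fits, `lineErr ≤ ε₁HΛ^{β−1}` (`eventually_lineErr_le`),
`|f(σ₁)| ≍ (log log/log)^{−b̂(0)}` loses against `Λ^{β−1−c₁}` at `σ₁` and wins against `Λ^{β−1−c₂}` at `σ₂`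
((25): "the first is larger on `σ₁`, and the second is larger on `σ₂`"), and the Rouché margin tends to
`≤ 1/16`. [cite: Montgomery1983, §4 (25) and p. 506] -/
theorem eventually_good (hA₂ : 0 ≤ A₂) (hA₃ : 0 ≤ A₃) (hA₄ : 0 ≤ A₄)
    (hcs : 0 < montgomeryCoeff m 1 - montgomeryCoeff m 0 - 1) {H q₀ q₁ Lq ρ₁ ρ₂ ρ₃ : ℝ} (hH : 0 ≤ H)
    (hq₀ : 0 < q₀) (hq₁ : 0 < q₁) (hρ₁ : 0 < ρ₁) (hρ₂ : 0 < ρ₂) (hρ₃ : 0 ≤ ρ₃) :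
    ∃ ε₁ : ℝ, 0 < ε₁ ∧ ∀ᶠ Λ : ℝ in atTop,
      20 ≤ Λ ∧ (A₃ + A₄ * Real.log 6) ^ 2 ≤ Λ ∧
      12 ≤ (montgomeryCoeff m 1 - montgomeryCoeff m 0 - 1) / 2 * Real.log Λ ∧
      (montgomeryCoeff m 1 - montgomeryCoeff m 0 - 1 + 1) * Real.log Λ + 6 ≤ Λ / 64 ∧
      (∀ (a : ℝ) (K : ℕ), 1 / Λ ≤ a → 1 ≤ K → (K : ℝ) ≤ Λ ^ 4 →
        lineErr m A₁ A₂ A₃ A₄ H Λ a (Λ ^ (-(1 / 2 : ℝ))) K ≤ ε₁ * H * Λ ^ (montgomeryCoeff m 1 - 1)) ∧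
      ρ₂ * (((montgomeryCoeff m 1 - montgomeryCoeff m 0 - 1) / 2 * Real.log Λ / Λ) ^
          (-montgomeryCoeff m 0) * Real.exp (A₁ + A₂ * Real.log (Real.log 5))) <
        Λ ^ (montgomeryCoeff m 1 - 1) / Real.Gamma (montgomeryCoeff m 1) *
          Real.exp (-(A₁ + A₂ * Real.log (Real.log 6))) * q₀ *
          Real.exp (-((montgomeryCoeff m 1 - montgomeryCoeff m 0 - 1) / 2 * Real.log Λ)) ∧
      Λ ^ (montgomeryCoeff m 1 - 1) / Real.Gamma (montgomeryCoeff m 1) *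
          Real.exp (A₁ + A₂ * Real.log (Real.log 6)) * q₁ *
          Real.exp (-((montgomeryCoeff m 1 - montgomeryCoeff m 0 - 1 + 1) * Real.log Λ)) <
        ρ₁ * (((montgomeryCoeff m 1 - montgomeryCoeff m 0 - 1 + 1) * Real.log Λ / Λ) ^
          (-montgomeryCoeff m 0) * Real.exp (-(A₁ + A₂ * Real.log (Real.log 5)))) ∧
      Real.exp (1 / 2) *
          (Real.exp 1 / (2 * Real.pi) * (ε₁ * H + 44 * Λ ^ (-1 - montgomeryCoeff m 1)) *
              Real.Gamma (montgomeryCoeff m 1) * Real.exp (A₁ + A₂ * Real.log (Real.log 6)) +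
            5 * Lq / Λ) / q₀ +
        5 * (ρ₂ * ((((montgomeryCoeff m 1 - montgomeryCoeff m 0 - 1 + 1) * Real.log Λ + 6) / Λ) ^
              (-montgomeryCoeff m 0) * Real.exp (A₁ + A₂ * Real.log (Real.log 5)) *
            ((-montgomeryCoeff m 0) * (Λ / ((montgomeryCoeff m 1 - montgomeryCoeff m 0 - 1) / 2 *
              Real.log Λ - 1)) + (A₃ + A₄ * Real.log 5))) +
            ρ₃ * ((((montgomeryCoeff m 1 - montgomeryCoeff m 0 - 1 + 1) * Real.log Λ + 6) / Λ) ^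
              (-montgomeryCoeff m 0) * Real.exp (A₁ + A₂ * Real.log (Real.log 5)))) /
          (Λ * (ρ₁ * ((((montgomeryCoeff m 1 - montgomeryCoeff m 0 - 1) / 2 * Real.log Λ - 1) / Λ) ^
            (-montgomeryCoeff m 0) * Real.exp (-(A₁ + A₂ * Real.log (Real.log 5)))))) < 1 / 8 := by
  set b₁ := montgomeryCoeff m 1 with hb₁
  set b₀ := montgomeryCoeff m 0 with hb₀
  set cs := b₁ - b₀ - 1 with hcsdef
  set c₁ := cs / 2 with hc₁def
  set c₂ := cs + 1 with hc₂def
  set γ := -b₀ with hγ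
  set ℓ₀ := A₁ + A₂ * Real.log (Real.log 5) with hℓ₀
  set ℓ₁ := A₁ + A₂ * Real.log (Real.log 6) with hℓ₁
  set L₀ := A₃ + A₄ * Real.log 5 with hL₀
  have hγ0 : 0 < γ := by have := (montgomeryCoeff_zero_bounds m).2; rw [hγ, hb₀]; linarith only [this]
  have hγ1 : γ < 1 := by have := (montgomeryCoeff_zero_bounds m).1; rw [hγ, hb₀]; linarith only [this]
  have hβ0 : 0 < b₁ := by have := (montgomeryCoeff_one_bounds m).1; rw [hb₁]; linarith only [this]
  have hc₁pos : 0 < c₁ := by rw [hc₁def]; linarith only [hcs]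
  have hc₂1 : 1 ≤ c₂ := by rw [hc₂def]; linarith only [hcs]
  have hc₁₂ : c₁ ≤ c₂ := by rw [hc₁def, hc₂def]; linarith only [hcs]
  have hL₀0 : 0 ≤ L₀ := add_nonneg hA₃ (mul_nonneg hA₄ (Real.log_nonneg (by norm_num)))
  have hΓ : 0 < Real.Gamma b₁ := Real.Gamma_pos_of_pos hβ0
  -- the fixed `ε₁`
  set ε₁ : ℝ := q₀ / (100 * (H + 1) * Real.Gamma b₁ * Real.exp ℓ₁) with hε₁
  have hε₁pos : 0 < ε₁ := by rw [hε₁]; positivity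
  refine ⟨ε₁, hε₁pos, ?_⟩
  -- numerical constants
  have he : Real.exp 1 < 2.7182818286 := Real.exp_one_lt_d9
  have he2 : Real.exp (3 / 2) ≤ 8 := by
    have h1 : Real.exp (3 / 2) ≤ Real.exp 2 := Real.exp_le_exp.2 (by norm_num)
    have h2 : Real.exp 2 = Real.exp 1 * Real.exp 1 := by rw [← Real.exp_add]; norm_num
    nlinarith [Real.exp_pos 1]
  have hπ := Real.pi_gt_three
  -- the individual eventual conditions
  have hlog := Real.tendsto_log_atTop
  have E1 : ∀ᶠ Λ : ℝ in atTop, 20 ≤ Λ := eventually_ge_atTop _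
  have E2 : ∀ᶠ Λ : ℝ in atTop, (A₃ + A₄ * Real.log 6) ^ 2 ≤ Λ := eventually_ge_atTop _
  have E3 : ∀ᶠ Λ : ℝ in atTop, 12 ≤ c₁ * Real.log Λ :=
    (hlog.const_mul_atTop hc₁pos).eventually_ge_atTop 12
  have E4 : ∀ᶠ Λ : ℝ in atTop, c₂ * Real.log Λ + 6 ≤ Λ / 64 := by
    have h := Real.isLittleO_log_id_atTop.def (show 0 < 1 / (128 * c₂) by positivity)
    filter_upwards [h, eventually_ge_atTop (768 : ℝ), eventually_ge_atTop (1 : ℝ)] with Λ hΛ h768 h1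
    rw [Real.norm_eq_abs, Real.norm_eq_abs, abs_of_nonneg (Real.log_nonneg h1), id, abs_of_nonneg (by linarith)] at hΛ
    have : c₂ * Real.log Λ ≤ Λ / 128 := by
      calc c₂ * Real.log Λ ≤ c₂ * (1 / (128 * c₂) * Λ) := mul_le_mul_of_nonneg_left hΛ (by linarith)
        _ = Λ / 128 := by field_simp
    linarith
  have E5 := eventually_lineErr_le m (A₁ := A₁) hA₂ hA₃ hA₄ hcs hε₁pos
  -- E6: `K LL^γ < Λ^{cs/2}`
  set K₆ : ℝ := ρ₂ * Real.Gamma b₁ * Real.exp ℓ₁ * Real.exp ℓ₀ * c₁ ^ γ / q₀ with hK₆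
  have hK₆pos : 0 < K₆ := by rw [hK₆]; positivity
  have E6 : ∀ᶠ Λ : ℝ in atTop, K₆ * Real.log Λ ^ γ < Λ ^ (cs / 2) := by
    have h := (isLittleO_log_rpow_rpow_atTop γ (show 0 < cs / 2 by linarith)).def (show 0 < 1 / (2 * K₆) by positivity)
    filter_upwards [h, eventually_gt_atTop (1 : ℝ)] with Λ hΛ h1
    rw [Real.norm_eq_abs, Real.norm_eq_abs, abs_of_nonneg (Real.rpow_nonneg (Real.log_nonneg h1.le) _),
      abs_of_nonneg (Real.rpow_nonneg (by linarith) _)] at hΛ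
    have hpos : 0 < Λ ^ (cs / 2) := Real.rpow_pos_of_pos (by linarith) _
    calc K₆ * Real.log Λ ^ γ ≤ K₆ * (1 / (2 * K₆) * Λ ^ (cs / 2)) := mul_le_mul_of_nonneg_left hΛ hK₆pos.le
      _ = Λ ^ (cs / 2) / 2 := by field_simp
      _ < Λ ^ (cs / 2) := by linarith
  -- E7
  have E7 : ∀ᶠ Λ : ℝ in atTop, q₁ * Real.exp ℓ₁ * Real.exp ℓ₀ / (Real.Gamma b₁ * ρ₁) < Λ := eventually_gt_atTop _
  -- E8: the three vanishing parts of the margin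
  have E8a : ∀ᶠ Λ : ℝ in atTop, Real.exp (1 / 2) * (Real.exp 1 / (2 * Real.pi) * (44 * Λ ^ (-1 - b₁)) *
      Real.Gamma b₁ * Real.exp ℓ₁) / q₀ < 1 / 48 := by
    have h : Tendsto (fun Λ : ℝ ↦ Real.exp (1 / 2) * (Real.exp 1 / (2 * Real.pi) * (44 * Λ ^ (-(1 + b₁))) *
        Real.Gamma b₁ * Real.exp ℓ₁) / q₀) atTop (𝓝 0) := by
      have := tendsto_rpow_neg_atTop (show 0 < 1 + b₁ by linarith)
      have h2 : Tendsto (fun Λ : ℝ ↦ Real.exp (1 / 2) * (Real.exp 1 / (2 * Real.pi) * (44 * Λ ^ (-(1 + b₁))) *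
          Real.Gamma b₁ * Real.exp ℓ₁) / q₀) atTop
          (𝓝 (Real.exp (1 / 2) * (Real.exp 1 / (2 * Real.pi) * (44 * 0) * Real.Gamma b₁ * Real.exp ℓ₁) / q₀)) :=
        (((((this.const_mul 44).const_mul _).mul_const _).mul_const _).const_mul _).div_const _
      simpa using h2
    have := h.eventually_lt_const (show (0 : ℝ) < 1 / 48 by norm_num)
    filter_upwards [this] with Λ hΛ
    rwa [show -(1 + b₁) = -1 - b₁ by ring] at hΛ
  have E8b : ∀ᶠ Λ : ℝ in atTop, Real.exp (1 / 2) * (5 * Lq / Λ) / q₀ < 1 / 48 := by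
    have h : Tendsto (fun Λ : ℝ ↦ Real.exp (1 / 2) * (5 * Lq / Λ) / q₀) atTop (𝓝 0) := by
      have := (tendsto_const_nhds (x := (5 * Lq : ℝ))).div_atTop tendsto_id
      simpa using (this.const_mul (Real.exp (1 / 2))).div_const q₀
    exact h.eventually_lt_const (by norm_num)
  set ρ : ℝ := 2 * c₂ / c₁ + 1 with hρ
  have hρ1 : 1 ≤ ρ := by
    have : 0 ≤ 2 * c₂ / c₁ := by positivity
    rw [hρ]; linarith only [this]
  have E8c : ∀ᶠ Λ : ℝ in atTop, 5 / ρ₁ * (Real.exp ℓ₀ * Real.exp ℓ₀) * ρ *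
      (ρ₂ * (γ / (c₁ * Real.log Λ - 1) + L₀ / Λ) + ρ₃ / Λ) < 1 / 48 := by
    have h1 : Tendsto (fun Λ : ℝ ↦ c₁ * Real.log Λ - 1) atTop atTop :=
      tendsto_atTop_add_const_right _ _ (hlog.const_mul_atTop hc₁pos)
    have h2 : Tendsto (fun Λ : ℝ ↦ γ / (c₁ * Real.log Λ - 1)) atTop (𝓝 0) := tendsto_const_nhds.div_atTop h1
    have h3 : Tendsto (fun Λ : ℝ ↦ L₀ / Λ) atTop (𝓝 0) := tendsto_const_nhds.div_atTop tendsto_id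
    have h3' : Tendsto (fun Λ : ℝ ↦ ρ₃ / Λ) atTop (𝓝 0) := tendsto_const_nhds.div_atTop tendsto_id
    have h4 : Tendsto (fun Λ : ℝ ↦ 5 / ρ₁ * (Real.exp ℓ₀ * Real.exp ℓ₀) * ρ *
        (ρ₂ * (γ / (c₁ * Real.log Λ - 1) + L₀ / Λ) + ρ₃ / Λ)) atTop
        (𝓝 (5 / ρ₁ * (Real.exp ℓ₀ * Real.exp ℓ₀) * ρ * (ρ₂ * (0 + 0) + 0))) :=
      (((h2.add h3).const_mul ρ₂).add h3').const_mul _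
    simp only [add_zero, mul_zero] at h4
    exact h4.eventually_lt_const (by norm_num)
  -- combine
  filter_upwards [E1, E2, E3, E4, E5, E6, E7, E8a, E8b, E8c, eventually_ge_atTop (3 : ℝ)]
    with Λ g1 g2 g3 g4 g5 g6 g7 g8a g8b g8c hΛ3
  have hΛ0 : 0 < Λ := by linarith only [g1]
  set LL := Real.log Λ with hLL
  have hLL1 : 1 ≤ LL := by
    rw [hLL, ← Real.log_exp 1]; exact Real.log_le_log (Real.exp_pos 1) (by linarith only [hΛ3, he])
  have hLL0 : 0 < LL := by linarith only [hLL1]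
  refine ⟨g1, g2, g3, g4, fun a K ha hK hKΛ ↦ g5 H a K hH ha hK hKΛ, ?_, ?_, ?_⟩
  · -- g6
    have eL : (c₁ * LL / Λ) ^ γ = c₁ ^ γ * LL ^ γ * (Λ ^ γ)⁻¹ := by
      rw [Real.div_rpow (by positivity) hΛ0.le, Real.mul_rpow hc₁pos.le hLL0.le, div_eq_mul_inv]
    have eR : Real.exp (-(c₁ * LL)) = Λ ^ (-c₁) := by
      rw [Real.rpow_def_of_pos hΛ0, hLL]; congr 1; ring
    have epow : Λ ^ (b₁ - 1) * Λ ^ (-c₁) = Λ ^ (cs / 2) * (Λ ^ γ)⁻¹ := by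
      rw [← Real.rpow_neg hΛ0.le γ, ← Real.rpow_add hΛ0, ← Real.rpow_add hΛ0]
      congr 1; rw [hc₁def, hcsdef, hγ]; ring
    rw [eL, eR]
    have hinv : 0 < (Λ ^ γ)⁻¹ := inv_pos.2 (Real.rpow_pos_of_pos hΛ0 _)
    have key' : (ρ₂ * (c₁ ^ γ * LL ^ γ * Real.exp ℓ₀)) * (Real.Gamma b₁ * Real.exp ℓ₁ / q₀) < Λ ^ (cs / 2) := by
      calc (ρ₂ * (c₁ ^ γ * LL ^ γ * Real.exp ℓ₀)) * (Real.Gamma b₁ * Real.exp ℓ₁ / q₀) = K₆ * LL ^ γ := by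
            rw [hK₆]; ring
        _ < Λ ^ (cs / 2) := g6
    have key : ρ₂ * (c₁ ^ γ * LL ^ γ * Real.exp ℓ₀) < Λ ^ (cs / 2) / Real.Gamma b₁ * Real.exp (-ℓ₁) * q₀ := by
      rw [show Λ ^ (cs / 2) / Real.Gamma b₁ * Real.exp (-ℓ₁) * q₀ = Λ ^ (cs / 2) / (Real.Gamma b₁ * Real.exp ℓ₁ / q₀) by
        rw [Real.exp_neg]; field_simp]
      exact (lt_div_iff₀ (by positivity)).2 key'
    calc ρ₂ * (c₁ ^ γ * LL ^ γ * (Λ ^ γ)⁻¹ * Real.exp ℓ₀) = (ρ₂ * (c₁ ^ γ * LL ^ γ * Real.exp ℓ₀)) * (Λ ^ γ)⁻¹ := by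
          ring
      _ < (Λ ^ (cs / 2) / Real.Gamma b₁ * Real.exp (-ℓ₁) * q₀) * (Λ ^ γ)⁻¹ :=
          mul_lt_mul_of_pos_right key hinv
      _ = Λ ^ (b₁ - 1) / Real.Gamma b₁ * Real.exp (-ℓ₁) * q₀ * Λ ^ (-c₁) := by
          rw [show Λ ^ (b₁ - 1) / Real.Gamma b₁ * Real.exp (-ℓ₁) * q₀ * Λ ^ (-c₁) =
            (Λ ^ (b₁ - 1) * Λ ^ (-c₁)) / Real.Gamma b₁ * Real.exp (-ℓ₁) * q₀ by ring, epow]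
          ring
  · -- g7
    have eL : (c₂ * LL / Λ) ^ γ = (c₂ * LL) ^ γ * (Λ ^ γ)⁻¹ := by
      rw [Real.div_rpow (by positivity) hΛ0.le, div_eq_mul_inv]
    have eR : Real.exp (-(c₂ * LL)) = Λ ^ (-c₂) := by
      rw [Real.rpow_def_of_pos hΛ0, hLL]; congr 1; ring
    have epow : Λ ^ (b₁ - 1) * Λ ^ (-c₂) = Λ ^ (-1 : ℝ) * (Λ ^ γ)⁻¹ := by
      rw [← Real.rpow_neg hΛ0.le γ, ← Real.rpow_add hΛ0, ← Real.rpow_add hΛ0]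
      congr 1; rw [hc₂def, hcsdef, hγ]; ring
    have hone : 1 ≤ (c₂ * LL) ^ γ := Real.one_le_rpow (by nlinarith only [hc₂1, hLL1]) hγ0.le
    rw [eL, eR]
    have hinv : 0 < (Λ ^ γ)⁻¹ := inv_pos.2 (Real.rpow_pos_of_pos hΛ0 _)
    have key : q₁ * Real.exp ℓ₁ / Real.Gamma b₁ * Λ ^ (-1 : ℝ) < ρ₁ * ((c₂ * LL) ^ γ * Real.exp (-ℓ₀)) := by
      have h0 : (q₁ * Real.exp ℓ₁ * Real.exp ℓ₀ / (Real.Gamma b₁ * ρ₁)) / Λ < 1 := (div_lt_one hΛ0).2 g7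
      have h1 : q₁ * Real.exp ℓ₁ / Real.Gamma b₁ * Λ ^ (-1 : ℝ) < ρ₁ * Real.exp (-ℓ₀) := by
        have e : q₁ * Real.exp ℓ₁ / Real.Gamma b₁ * Λ ^ (-1 : ℝ) =
            ((q₁ * Real.exp ℓ₁ * Real.exp ℓ₀ / (Real.Gamma b₁ * ρ₁)) / Λ) * (ρ₁ * Real.exp (-ℓ₀)) := by
          rw [Real.rpow_neg_one, Real.exp_neg]; field_simp
        rw [e]
        calc ((q₁ * Real.exp ℓ₁ * Real.exp ℓ₀ / (Real.Gamma b₁ * ρ₁)) / Λ) * (ρ₁ * Real.exp (-ℓ₀)) <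
            1 * (ρ₁ * Real.exp (-ℓ₀)) := mul_lt_mul_of_pos_right h0 (by positivity)
          _ = ρ₁ * Real.exp (-ℓ₀) := one_mul _
      calc q₁ * Real.exp ℓ₁ / Real.Gamma b₁ * Λ ^ (-1 : ℝ) < ρ₁ * Real.exp (-ℓ₀) := h1
        _ = ρ₁ * (1 * Real.exp (-ℓ₀)) := by rw [one_mul]
        _ ≤ ρ₁ * ((c₂ * LL) ^ γ * Real.exp (-ℓ₀)) :=
            mul_le_mul_of_nonneg_left (mul_le_mul_of_nonneg_right hone (Real.exp_pos _).le) hρ₁.le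
    calc Λ ^ (b₁ - 1) / Real.Gamma b₁ * Real.exp ℓ₁ * q₁ * Λ ^ (-c₂)
        = (q₁ * Real.exp ℓ₁ / Real.Gamma b₁ * Λ ^ (-1 : ℝ)) * (Λ ^ γ)⁻¹ := by
          rw [show Λ ^ (b₁ - 1) / Real.Gamma b₁ * Real.exp ℓ₁ * q₁ * Λ ^ (-c₂) =
            (Λ ^ (b₁ - 1) * Λ ^ (-c₂)) * Real.exp ℓ₁ * q₁ / Real.Gamma b₁ by ring, epow]
          ring
      _ < (ρ₁ * ((c₂ * LL) ^ γ * Real.exp (-ℓ₀))) * (Λ ^ γ)⁻¹ := mul_lt_mul_of_pos_right key hinv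
      _ = ρ₁ * ((c₂ * LL) ^ γ * (Λ ^ γ)⁻¹ * Real.exp (-ℓ₀)) := by ring
  · -- g8
    have h12 : 12 ≤ c₁ * LL := g3
    have hden : 0 < c₁ * LL - 1 := by linarith only [h12]
    -- the constant part
    have hprod : Real.exp (1 / 2) * Real.exp 1 = Real.exp (3 / 2) := by rw [← Real.exp_add]; norm_num
    have hconst : Real.exp (1 / 2) * (Real.exp 1 / (2 * Real.pi) * (ε₁ * H) * Real.Gamma b₁ * Real.exp ℓ₁) / q₀ ≤
        1 / 16 := by
      have e : Real.exp (1 / 2) * (Real.exp 1 / (2 * Real.pi) * (ε₁ * H) * Real.Gamma b₁ * Real.exp ℓ₁) / q₀ =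
          Real.exp (3 / 2) / (200 * Real.pi) * (H / (H + 1)) := by
        rw [hε₁, ← hprod]; field_simp; ring
      have hH1 : H / (H + 1) ≤ 1 := (div_le_one (by linarith)).2 (by linarith)
      rw [e]
      calc Real.exp (3 / 2) / (200 * Real.pi) * (H / (H + 1)) ≤ Real.exp (3 / 2) / (200 * Real.pi) * 1 :=
            mul_le_mul_of_nonneg_left hH1 (by positivity)
        _ ≤ 1 / 16 := by rw [mul_one, div_le_iff₀ (by positivity)]; linarith only [he2, hπ]
    -- the `D'/(Λ r₁)` part
    set X : ℝ := (c₂ * LL + 6) / (c₁ * LL - 1) with hX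
    have hc₂LL : 0 ≤ c₂ * LL := mul_nonneg (by linarith only [hc₂1]) hLL0.le
    have hX0 : 0 ≤ X := by rw [hX]; exact div_nonneg (by linarith only [hc₂LL]) hden.le
    have hXρ : X ≤ ρ := by
      rw [hX, hρ, div_le_iff₀ hden]
      have h1 : (2 * c₂ / c₁ + 1) * (c₁ * LL - 1) = 2 * (c₂ * LL) + c₁ * LL - 2 * (c₂ / c₁) - 1 := by
        field_simp
        ring
      have h2 : 12 * (c₂ / c₁) ≤ c₂ * LL :=
        calc 12 * (c₂ / c₁) = (c₂ / c₁) * 12 := by ring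
          _ ≤ (c₂ / c₁) * (c₁ * LL) := mul_le_mul_of_nonneg_left h12 (by positivity)
          _ = c₂ * LL := by field_simp
      have h3 : 0 ≤ c₂ / c₁ := by positivity
      rw [h1]; linarith only [h2, h3, h12]
    have hXγ : X ^ γ ≤ ρ := by
      rcases le_or_gt 1 X with h1 | h1
      · exact (Real.rpow_le_self_of_one_le h1 hγ1.le).trans hXρ
      · exact (Real.rpow_le_one hX0 h1.le hγ0.le).trans hρ1
    have hB0 : 0 ≤ (c₂ * LL + 6) / Λ := div_nonneg (by linarith only [hc₂LL]) hΛ0.le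
    have hb0 : 0 < (c₁ * LL - 1) / Λ := div_pos hden hΛ0
    have hTD : 5 * (ρ₂ * (((c₂ * LL + 6) / Λ) ^ γ * Real.exp ℓ₀ * (γ * (Λ / (c₁ * LL - 1)) + L₀)) +
          ρ₃ * (((c₂ * LL + 6) / Λ) ^ γ * Real.exp ℓ₀)) /
        (Λ * (ρ₁ * (((c₁ * LL - 1) / Λ) ^ γ * Real.exp (-ℓ₀)))) =
        5 / ρ₁ * (Real.exp ℓ₀ * Real.exp ℓ₀) * X ^ γ * (ρ₂ * (γ / (c₁ * LL - 1) + L₀ / Λ) + ρ₃ / Λ) := by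
      have hq : X = ((c₂ * LL + 6) / Λ) / ((c₁ * LL - 1) / Λ) := by rw [hX]; field_simp
      rw [hq, Real.div_rpow hB0 hb0.le, Real.exp_neg]
      have : ((c₁ * LL - 1) / Λ) ^ γ ≠ 0 := (Real.rpow_pos_of_pos hb0 _).ne'
      field_simp
    have hTDle : 5 / ρ₁ * (Real.exp ℓ₀ * Real.exp ℓ₀) * X ^ γ * (ρ₂ * (γ / (c₁ * LL - 1) + L₀ / Λ) + ρ₃ / Λ) ≤
        5 / ρ₁ * (Real.exp ℓ₀ * Real.exp ℓ₀) * ρ * (ρ₂ * (γ / (c₁ * LL - 1) + L₀ / Λ) + ρ₃ / Λ) := by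
      have : 0 ≤ ρ₂ * (γ / (c₁ * LL - 1) + L₀ / Λ) + ρ₃ / Λ := by positivity
      exact mul_le_mul_of_nonneg_right (mul_le_mul_of_nonneg_left hXγ (by positivity)) this
    -- combine
    have hsplit : Real.exp (1 / 2) * (Real.exp 1 / (2 * Real.pi) * (ε₁ * H + 44 * Λ ^ (-1 - b₁)) * Real.Gamma b₁ *
        Real.exp ℓ₁ + 5 * Lq / Λ) / q₀ =
        Real.exp (1 / 2) * (Real.exp 1 / (2 * Real.pi) * (ε₁ * H) * Real.Gamma b₁ * Real.exp ℓ₁) / q₀ +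
        Real.exp (1 / 2) * (Real.exp 1 / (2 * Real.pi) * (44 * Λ ^ (-1 - b₁)) * Real.Gamma b₁ * Real.exp ℓ₁) / q₀ +
        Real.exp (1 / 2) * (5 * Lq / Λ) / q₀ := by ring
    rw [hsplit, hTD]
    linarith only [hconst, g8a, g8b, g8c, hTDle]

end Generic

end Literature.Barriers.RiemannHypothesis

end
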